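import Summits.BirchSwinnertonDyer.Rank1Residual.X11b.BDPRouteOpenInputSplit
import Summits.BirchSwinnertonDyer.Rank1Residual.X11b.BDPRouteHsiehFrameSupplied
import HarnessLib

/-!
# Class X11b, route p2 at `p ≥ 5`: the RECORDS over the split open input — the SEMISTABLE END STATE
# from published + cited facts and (2.4)∃♭ ALONE, and the class record with the value shape typed
# only on NON-semistable pairs (cell `b2b-bsdres`, sub-cell `multr1-p2`, gen 25; sequel of
# `BDPRouteOpenInputSplit.lean`)

HONEST FRAMING (cell `b2b-bsdres`, run/shared/lean/b2b/bsd-rank1-residual/, verbatim in every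
file): the goal of the cell is to DELETE the COMBINATION-SHAPED residual classes of the
Birch–Swinnerton-Dyer formula for ALL analytic-rank `≤ 1` elliptic curves over `ℚ` — "full BSD
formula for every rank `≤ 1` curve in class `C`" assembled STRICTLY from published theorems — so
that the rank-`≤ 1` remainder becomes exactly the CONSTRUCTION-SHAPED classes, which are TYPED
(missing-input `Prop`s), NOT attempted. This is not "finishing BSD". Sub-cell `multr1-p2` is a
RESEARCH ROUTE on class X11b (`ClassX11b W p := r_an = 1 ∧ p ≠ 2 ∧ mult(p) ∧ irr(p)`,
`Partition/Rows.lean`); no claim beyond the stated class and loci; X11b's label does not change;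
NOTHING is booked by this file.

THEOREMS ONLY (no definition, no named fact, no `sorry`).

## What this file proves

* §1 **`P2.bsdp_of_semistable_of_imcDivSomeFrame`** — THE SEMISTABLE END STATE OF ROUTE p2 (gen 25):
  every SEMISTABLE X11b pair at `p ≥ 5` (753 185 ‖ 30 086 = 33 % of the shape): `BSD(E,p)` ⇐ route
  p2's and the lever's PUBLISHED named facts (incl. `h32` = Cas18 Thms. 3.1–3.2) + the cited
  Poitou–Tate / local Euler characteristic + **(2.4)∃♭ AT THE PAIR** (`P2.IMCDivSomeFrameOnTree W p`:
  per datum SOME BDP frame over `𝓞_{ℂ_p}⟦T⟧` with Castella's interpolation and the erratum's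
  divisibility — NO value clause, NO `R₀`) + [NOTHING on the Locus (723 144) ∣ ONE certificate (REG;
  or TC if `p ∤ ∏c`) off it (30 041)]. Gen 24's `P2.bsdp_of_semistable_of_imcDivIntFrame` with H∃♭
  assembled by the split (`P2.imcDivIntFrameOnTree_of_imcDivSomeFrame_of_semistable`).
* §2 **`P2.bsdp_of_onTree_split`** — CLASS RECORD: `∀ (E,p) ∈` X11b, `p ≥ 5 → BSD(E,p)` ⇐ PUB (incl.
  `h32`) + cited + **(2.4)∃♭ on EVERY pair** + value∃♭ (`P2.BDPValueSomeFrameOnTree`) ONLY on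
  NON-semistable pairs (1 514 163; PUB shape beyond the printed square-free scope) + (REG) per pair +
  (TC) on 54 755 + conjecture on 334 + corner 64. Gen 24's `P2.bsdp_of_onTree_intFrame` with H∃♭ from
  the split, case by case on `Semistable W`.
* §3 **`P2.imcDivSomeFrameOnTree_of_hsieh2014_of_forall_hsiehWitness_dvd`** — THE OPEN STATEMENT READ ON
  HSIEH'S PUBLISHED OBJECT: Hsieh 2014 Thm. 1 (`hH`) + [at every datum, EVERY Hsieh witness `Q` has
  `Ch_Λ(X_ac)·𝓞_{ℂ_p}⟦T⟧ ⊆ (Q)`] ⟹ (2.4)∃♭ (the witness EXISTS by gen 25's λ-supply, and the unit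
  re-normalisation `Q ↦ c·Q` of gen 24's glue does not change the ideal).

HONEST READING (no fact filed, no mark): THE open statement of route p2 is `P2.IMCDivSomeFrameOnTree`
((2.4) for some BDP frame; PREPRINT ⇐ [FW21 Thm. 4.41] / [Castella 2024]) on every pair; on the
non-semistable pairs the route additionally types the BDP value formula for some frame (PUB shape,
printed beyond square-free level only in [cas-split] Thm. 2.11 (split `p ≥ 5`, `a_p = +1`,
continuous-function currency) and [Castella 2024] (PRE)). CONDITIONAL; nothing booked; labels
UNCHANGED; X11b stays CONSTRUCTION-SHAPED.

References: [Castella2018] Thms. 2.3, 3.1, 3.2, §5; [Castella2018Erratum] (2.4), Thm. 1.1;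
[Skinner2016PacificMC] Thm. C; [McCallumLMS1991] §1; [Disegni2020] Thm. 1; [Wuthrich2014] Thm. 3,
Prop. 21; [SteinWuthrich2013] Thm. 6.1; [Serre1972] §5.4 Prop. 21; [Miller2011LMS] Def. 1.1.
-/

noncomputable section

open scoped Classical NumberField

open WeierstrassCurve NumberField IsDedekindDomain Field PowerSeries
open Literature.NumberTheory.EllipticCurves Literature.NumberTheory.EllipticCurves.GreenbergSelmer
open Literature.NumberTheory.EllipticCurves.ModularForms
open Literature.NumberTheory.EllipticCurves.Rank1Residual
open Literature.NumberTheory.EllipticCurves.Rank1Residual.Typed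
open Literature.NumberTheory.EllipticCurves.Wuthrich2014
open Literature.NumberTheory.EllipticCurves.Castella2018
open Literature.NumberTheory.EllipticCurves.SteinWuthrich2013
open Literature.NumberTheory.EllipticCurves.Disegni2020
open Literature.NumberTheory.EllipticCurves.Skinner2016
open Literature.NumberTheory.EllipticCurves.BalakrishnanEtAl2019
open Literature.NumberTheory.QuadraticFields.Quadratic
open Literature.NumberTheory.GaloisRepresentations Literature.NumberTheory.GaloisCohomology
open Literature.NumberTheory.Automorphic
open Summit.BirchSwinnertonDyer.Rank1Residual.X11b.AcSelmer
open Summit.BirchSwinnertonDyer.Rank1Residual.X11b.Halves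

namespace Summit.BirchSwinnertonDyer.Rank1Residual.X11b

variable {W : WeierstrassCurve ℚ} [W.IsElliptic] [W.IsGloballyMinimal] {p : ℕ} [Fact p.Prime]

/-! ### §1 The semistable end state over (2.4)∃♭ alone -/

/-- **ROUTE p2 — SEMISTABLE END STATE (gen 25): every SEMISTABLE X11b pair at `p ≥ 5` from PUBLISHED
+ cited facts and (2.4)∃♭ AT THE PAIR.** `BSD(E,p)` for `E` semistable, `(E,p)` ∈ X11b, `p ≥ 5`
(753 185 ‖ 30 086 pairs), from: route p2's published named facts (GZ, Kolyvagin ×2, Skinner C,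
Wuthrich, GZK, modularity, Hoffstein–Luo, Mazur) + the lever's (Kato divisibility, SW13 Thm. 6.1 ×2,
Disegni Thm. 1, parametrisations) + Cas18 Thms. 3.1–3.2 (`h32`, PUBLISHED, semistable scope) + the
cited PT / EP, the OPEN input **(2.4)∃♭ `P2.IMCDivSomeFrameOnTree W p`** (per datum SOME BDP frame over
`𝓞_{ℂ_p}⟦T⟧` with Castella's interpolation and the erratum's divisibility; NO value clause — ♭-V1RIG
reads the value at `𝟙` off Castella's own frame, which `h32` provides), and — ONLY OFF THE LOCUS
(30 041 pairs) — ONE per-pair certificate: REG, or TC when `p ∤ ∏c`. On the semistable Locus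
(723 144) NOTHING per pair. CONDITIONAL; nothing booked; labels UNCHANGED; X11b stays
CONSTRUCTION-SHAPED. [cite: Castella2018Erratum, (2.4) (p. 4)] [cite: Castella2018, Thms. 2.3, 3.1, 3.2, §5]
[cite: Skinner2016PacificMC, Thm. C (§1)] [cite: McCallumLMS1991, §1 Theorem (Kolyvagin), p. 296]
[cite: Disegni2020, Thm. 1 (§1.2), (∗)] [cite: Wuthrich2014, Thm. 3 (p. 383), Prop. 21 (p. 400)]
[cite: SteinWuthrich2013, Thm. 6.1, §4.2] [cite: Serre1972, §5.4 Prop. 21 i)] [cite: Miller2011LMS, Def. 1.1] -/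
theorem P2.bsdp_of_semistable_of_imcDivSomeFrame
    -- route p2's published inputs
    (hGZ : ∀ (N : ℕ) [NeZero N] (W : WeierstrassCurve ℚ) (K : Type) [Field K] [NumberField K],
      gross_zagier N W K)
    (hKo : ∀ (N : ℕ) [NeZero N] (W : WeierstrassCurve ℚ) (K : Type) [Field K] [NumberField K],
      kolyvagin N W K)
    (hB : ∀ (N : ℕ) [NeZero N] (W : WeierstrassCurve ℚ) (K : Type) [Field K] [NumberField K],
      Kolyvagin1990_padicValNat_card_sha_le N W K)
    (hSk : Skinner2016.thmC_padicValRat_bsd_rank_zero) (hWu : sha_dvd_analyticSha)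
    (hGZK : rank_eq_analyticRank_of_analyticRank_le_one) (hnf : exists_isNewformOf)
    (hHL : HoffsteinLuo1997_exists_twist_L_one_ne_zero) (hMaz : mazur_not_dvd_maninConstant_of_odd)
    (hPT : ∀ (K : Type) [Field K] [NumberField K], poitouTate_sum_localTatePairing_eq_zero K)
    (hEP : ∀ (K : Type) [Field K] [NumberField K] (v : HeightOneSpectrum (𝓞 K)),
      localEulerPoincareCharacteristic (v.adicCompletion K))
    -- Castella 2018 Thms. 3.1–3.2 (PUBLISHED; semistable scope)
    (h32 : thm32_exists_isBDPLFunction_valueAtOne)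
    -- the lever's published inputs
    (hK : kato_charIdeal_dvd_multiplicative_of_surjective)
    (hJn : thm61_nonsplitMultiplicative) (hJs : thm61_splitMultiplicative)
    (hHn : exists_isMultCanonical) (hHs : exists_isSplitMultCanonical)
    (hD : thm1_padicBSD_rankOne_multiplicative) (hpar : nonempty_modularParametrizationData)
    -- the pair: semistable X11b, `p ≥ 5`; (2.4)∃♭ at the pair
    (hss : Semistable W) (hDiv : P2.IMCDivSomeFrameOnTree W p) (hX : ClassX11b W p) (hp5 : 5 ≤ p)
    -- OFF the Locus: ONE certificate — the `p`-adic height, or (`p ∤ ∏c`) a twist certificate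
    (hcert : ¬ (Ram W p ∧ ¬ p ∣ W.tamagawaProduct) →
      ClassClosure.RegulatorNonvanishingAt W p ∨
      (¬ p ∣ W.tamagawaProduct ∧
        ∃ (K : Type) (_ : Field K) (_ : NumberField K) (Wd : WeierstrassCurve ℚ) (_ : Wd.IsElliptic)
          (_ : Wd.IsGloballyMinimal) (Cd : VariableChange ℚ) (qd : ℚ),
          IsImaginaryQuadratic K ∧ SatisfiesHeegnerHypothesis (W.conductorNorm ℤ) K ∧
          NumberField.discr K < -4 ∧ Cd • W.quadraticTwist (NumberField.discr K : ℚ) = Wd ∧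
          Wd.entireLFunction 1 / (Wd.realPeriodRat : ℂ) = (qd : ℂ) ∧ qd ≠ 0 ∧ padicValRat p qd = 0)) :
    BSDp W p :=
  P2.bsdp_of_semistable_of_imcDivIntFrame W p hGZ hKo hB hSk hWu hGZK hnf hHL hMaz hPT hEP hK hJn hJs
    hHn hHs hD hpar hss (P2.imcDivIntFrameOnTree_of_imcDivSomeFrame_of_semistable h32 hss hDiv) hX hp5 hcert

/-! ### §2 The class record over the split -/

/-- **ROUTE p2 — STATEMENT OF RECORD OVER THE SPLIT OPEN INPUT (gen 25).** `∀ (E, p) ∈` X11b,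
`p ≥ 5 → BSD(E, p)` from route p2's and the lever's published named facts (+ Kolyvagin 1990 Thm. A,
Cas18 Thms. 3.1–3.2 `h32`), the cited Poitou–Tate / local Euler characteristic, and the typed inputs:
**(2.4)∃♭ `P2.IMCDivSomeFrameOnTree` ON EVERY PAIR** — THE one open statement (the erratum's IMC
divisibility for some BDP frame over `𝓞_{ℂ_p}⟦T⟧`; PREPRINT); the value shape
`P2.BDPValueSomeFrameOnTree` ONLY on NON-semistable pairs (PUB shape; on semistable pairs it is `h32`);
(REG) per pair; (TC) on split-only pairs with `p ∤ ∏c`; the exceptional conjecture on split-only pairs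
with `p ∣ ∏c`; the corner. Gen 24's `P2.bsdp_of_onTree_intFrame` with H∃♭ from the split
(`P2.imcDivIntFrameOnTree_of_someFrames`; semistable case via `h32`). CONDITIONAL; nothing booked;
labels UNCHANGED; X11b stays CONSTRUCTION-SHAPED. [cite: Castella2018Erratum, (2.4) (p. 4)]
[cite: Castella2018, Thms. 2.3, 3.1, 3.2] [cite: Hsieh2014, p. 7 (arXiv:1112.1580)]
[cite: McCallumLMS1991, §1 Theorem (Kolyvagin), p. 296] [cite: Disegni2020, Thm. 1 (§1.2), Thm. 4, (∗)]
[cite: Wuthrich2014, Thm. 3 (p. 383), Prop. 21 (p. 400)] [cite: SteinWuthrich2013, Thm. 6.1, §4.2]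
[cite: Miller2011LMS, Def. 1.1] -/
theorem P2.bsdp_of_onTree_split
    -- route p2's published inputs
    (hGZ : ∀ (N : ℕ) [NeZero N] (W : WeierstrassCurve ℚ) (K : Type) [Field K] [NumberField K],
      gross_zagier N W K)
    (hKo : ∀ (N : ℕ) [NeZero N] (W : WeierstrassCurve ℚ) (K : Type) [Field K] [NumberField K],
      kolyvagin N W K)
    (hB : ∀ (N : ℕ) [NeZero N] (W : WeierstrassCurve ℚ) (K : Type) [Field K] [NumberField K],
      Kolyvagin1990_padicValNat_card_sha_le N W K)
    (hWu : sha_dvd_analyticSha) (hGZK : rank_eq_analyticRank_of_analyticRank_le_one)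
    (hnf : exists_isNewformOf) (hHL : HoffsteinLuo1997_exists_twist_L_one_ne_zero)
    (hMaz : mazur_not_dvd_maninConstant_of_odd) (hBDMTV : thm12_not_le_normalizer_splitCartan)
    (hPT : ∀ (K : Type) [Field K] [NumberField K], poitouTate_sum_localTatePairing_eq_zero K)
    (hEP : ∀ (K : Type) [Field K] [NumberField K] (v : HeightOneSpectrum (𝓞 K)),
      localEulerPoincareCharacteristic (v.adicCompletion K))
    -- Castella 2018 Thms. 3.1–3.2 (PUBLISHED; semistable scope)
    (h32 : thm32_exists_isBDPLFunction_valueAtOne)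
    -- the lever's published inputs
    (hK : kato_charIdeal_dvd_multiplicative_of_surjective)
    (hJn : thm61_nonsplitMultiplicative) (hJs : thm61_splitMultiplicative)
    (hHn : exists_isMultCanonical) (hHs : exists_isSplitMultCanonical)
    (hD : thm1_padicBSD_rankOne_multiplicative) (hpar : nonempty_modularParametrizationData)
    -- THE ONE OPEN INPUT: (2.4)∃♭, every pair
    (hDiv : ∀ (W : WeierstrassCurve ℚ) [W.IsElliptic] [W.IsGloballyMinimal] (p : ℕ) [Fact p.Prime],
      ClassX11b W p → 5 ≤ p → P2.IMCDivSomeFrameOnTree W p)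
    -- the BDP value formula for some frame, ONLY on NON-semistable pairs (PUB shape)
    (hVal : ∀ (W : WeierstrassCurve ℚ) [W.IsElliptic] [W.IsGloballyMinimal] (p : ℕ) [Fact p.Prime],
      ClassX11b W p → 5 ≤ p → ¬ Semistable W → P2.BDPValueSomeFrameOnTree W p)
    -- (REG)
    (hReg : ∀ (W : WeierstrassCurve ℚ) [W.IsElliptic] [W.IsGloballyMinimal] (p : ℕ) [Fact p.Prime],
      ClassX11b W p → 5 ≤ p → ClassClosure.RegulatorNonvanishingAt W p)
    -- (TC) ONE twist certificate per split-only pair with `p ∤ ∏c`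
    (hTC : ∀ (W : WeierstrassCurve ℚ) [W.IsElliptic] [W.IsGloballyMinimal] (p : ℕ) [Fact p.Prime],
      ClassX11b W p → 5 ≤ p → W.HasSplitMultiplicativeReductionAtPrime p →
      (¬ ∃ (m : ℕ) (_ : Fact m.Prime), m ≠ p ∧ W.HasMultiplicativeReductionAtPrime m) →
      ¬ p ∣ W.tamagawaProduct →
      ∃ (K : Type) (_ : Field K) (_ : NumberField K) (Wd : WeierstrassCurve ℚ) (_ : Wd.IsElliptic)
        (_ : Wd.IsGloballyMinimal) (Cd : VariableChange ℚ) (qd : ℚ),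
        IsImaginaryQuadratic K ∧ SatisfiesHeegnerHypothesis (W.conductorNorm ℤ) K ∧
        NumberField.discr K < -4 ∧ Cd • W.quadraticTwist (NumberField.discr K : ℚ) = Wd ∧
        Wd.entireLFunction 1 / (Wd.realPeriodRat : ℂ) = (qd : ℂ) ∧ qd ≠ 0 ∧ padicValRat p qd = 0)
    -- (T2∗′) the exceptional conjecture, only on split-only pairs with `p ∣ ∏c`
    (hC : ∀ (W : WeierstrassCurve ℚ) [W.IsElliptic] [W.IsGloballyMinimal] (p : ℕ) [Fact p.Prime],
      ClassX11b W p → 5 ≤ p → W.HasSplitMultiplicativeReductionAtPrime p →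
      (¬ ∃ (m : ℕ) (_ : Fact m.Prime), m ≠ p ∧ W.HasMultiplicativeReductionAtPrime m) →
      p ∣ W.tamagawaProduct → ClassClosure.RelativeExceptionalLeadingTermAt W p)
    -- (T4′)
    (hCorner : ∀ (W : WeierstrassCurve ℚ) [W.IsElliptic] [W.IsGloballyMinimal] (p : ℕ)
      [Fact p.Prime], ClassX11b W p → ¬ Surj W p → (p = 5 ∨ p = 7) →
        p ∣ padicValInt p W.minimalDiscriminantInt → ¬ Ram W p → Typed.MissingPPartAt W p)
    (W : WeierstrassCurve ℚ) [W.IsElliptic] [W.IsGloballyMinimal] (p : ℕ) [Fact p.Prime]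
    (hX : ClassX11b W p) (hp5 : 5 ≤ p) : BSDp W p :=
  P2.bsdp_of_onTree_intFrame hGZ hKo hB hWu hGZK hnf hHL hMaz hBDMTV hPT hEP hK hJn hJs hHn hHs hD hpar
    (fun W _ _ p _ hX hp5 ↦ by
      by_cases hss : Semistable W
      · exact P2.imcDivIntFrameOnTree_of_imcDivSomeFrame_of_semistable h32 hss (hDiv W p hX hp5)
      · exact P2.imcDivIntFrameOnTree_of_someFrames (hDiv W p hX hp5) (hVal W p hX hp5 hss))
    hReg hTC hC hCorner W p hX hp5

/-- **The gen-24 record implies the gen-25 one pointwise** (H∃♭ ⟹ (2.4)∃♭), so nothing recorded before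
is lost. [claim: Castella2018Erratum, status: under-review] -/
theorem P2.imcDivSomeFrameOnTree_forall_of_imcDivIntFrame_forall
    (hF : ∀ (W : WeierstrassCurve ℚ) [W.IsElliptic] [W.IsGloballyMinimal] (p : ℕ) [Fact p.Prime],
      ClassX11b W p → 5 ≤ p → P2.IMCDivIntFrameOnTree W p)
    (W : WeierstrassCurve ℚ) [W.IsElliptic] [W.IsGloballyMinimal] (p : ℕ) [Fact p.Prime]
    (hX : ClassX11b W p) (hp5 : 5 ≤ p) : P2.IMCDivSomeFrameOnTree W p :=
  P2.imcDivSomeFrameOnTree_of_imcDivIntFrame (hF W p hX hp5)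

/-! ### §3 The open statement read on Hsieh's published object -/

omit [W.IsGloballyMinimal] in
/-- **(2.4)∃♭ FROM "(2.4) FOR HSIEH'S OBJECT".** If at every datum of route p2's open input EVERY Hsieh
witness `(A, Ω_K, C, Ω_p, Q)` (`0 < A`, `Ω_K ≠ 0`, `‖ι'⁻¹C‖ = 1`, `‖Ω_p‖ = 1`,
`IsHsiehLFunction ι' 𝔭_{ι'} κ γ f_{Dt} A Ω_K C Ω_p Q` — Hsieh 2014 Thm. 1's display) satisfies the
divisibility `Ch_Λ(X_ac^∅(E[p^∞]))·𝓞_{ℂ_p}⟦T⟧ ⊆ (Q)`, then (2.4)∃♭ `P2.IMCDivSomeFrameOnTree W p` holds: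
a witness EXISTS at the datum (`P2.exists_isHsiehLFunction_of_hsieh2014`: the published fact + the
λ-supply at every odd prime), gen 24's glue `exists_isBDPLFunctionInt_of_isHsiehLFunction` turns it
into a Castella-normalised ♭-frame `((16A²/p)^{1/4}Ω_K, Ω_p, c·Q)` with `c ∈ 𝓞_{ℂ_p}^×`, and
`(c·Q) = (Q)`. So route p2's ONE open statement may be typed as a ONE-SIDED statement about a
PUBLISHED object. CONDITIONAL on `hH` (published) and the ∀-witness divisibility (open: [CastellaHsieh2018
§3.3] / [Castella2018Erratum (2.4)] / [FW21 Thm. 4.41]); nothing booked.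
[cite: Hsieh2014, Thm. 1 (arXiv:1112.1580 pp. 3–4)] [cite: Castella2018Erratum, (2.4) (p. 4)]
[cite: Castella2018, Thm. 3.1 (arXiv:1704.06608 p. 9)] -/
theorem P2.imcDivSomeFrameOnTree_of_hsieh2014_of_forall_hsiehWitness_dvd
    (hH : hsieh2014_exists_anticyclotomicPAdicLFunction)
    (hVD : ∀ (N : ℕ) [NeZero N] (K : Type) [Field K] [NumberField K]
      (Dt : ModularParametrizationData W N) (H : HeegnerDatum N (NumberField.discr K)) (ι : K →+* ℂ)
      (P : (W.baseChange K).toAffine.Point),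
      ClassX11b W p → 5 ≤ p → Surj W p → W.conductorNorm ℤ = N → IsImaginaryQuadratic K →
      Odd (NumberField.discr K) → ¬ (p : ℤ) ∣ NumberField.discr K → ¬ p ∣ Units.torsionOrder K →
      SatisfiesHeegnerHypothesis N K →
      (W.quadraticTwist (NumberField.discr K : ℚ)).entireLFunction 1 ≠ 0 →
      WeierstrassCurve.Affine.Point.map ι.toRatAlgHom P = heegnerPointComplex Dt H →
      ¬ (p : ℤ) ∣ Dt.c → ¬ IsOfFinAddOrder P →
      ∀ (κ : ZpExtension K p), κ.IsAnticyclotomic →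
        ∀ (γ : Field.absoluteGaloisGroup K) [Fact (κ.IsTopGenerator γ)]
          (ι' : PadicAlgCl p ≃+* ℂ) (w₀ : InfinitePlace K) (P' : (W.baseChange K).toAffine.Point),
          WeierstrassCurve.Affine.Point.map w₀.embedding.toRatAlgHom P' = heegnerPointComplex Dt H →
          ∀ (e : K →+* ℚ_[p]),
            (∀ k : 𝓞 K, k ∈ (primeOfEmbeddingDatum p ι' w₀.embedding).asIdeal ↔ ‖e (k : K)‖ < 1) →
            ∀ (A : ℝ) (ΩK C : ℂ) (Ωp : ℂ_[p]) (Q : PowerSeries 𝓞_ℂ_[p]),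
              0 < A → ΩK ≠ 0 → ‖((ι'.symm C : PadicAlgCl p) : ℂ_[p])‖ = 1 → ‖Ωp‖ = 1 →
              IsHsiehLFunction ι' (primeOfEmbeddingDatum p ι' w₀.embedding) κ γ Dt.f A ΩK C Ωp Q →
              (XAc.charIdeal (W.baseChange K) p κ (primeOfEmbeddingDatum p ι' w₀.embedding) ∅ γ).map
                (PowerSeries.map (R1.toCpInt p)) ≤ Ideal.span {Q}) :
    P2.IMCDivSomeFrameOnTree W p := by
  intro N _ K _ _ Dt H ιK P hX h5 hs hN hK hodd hpd hμ hHN hLt hP hc hPinf κ hκ γ _ ι' w₀ P' hP' e he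
  obtain ⟨A, ΩK, C, Ωp, Q, hA, hΩK, hC, hΩp, hQ⟩ :=
    P2.exists_isHsiehLFunction_of_hsieh2014 W p hH Dt.isNewformOf hX hN hK hHN κ hκ γ ι' w₀
  have hdiv := hVD N K Dt H ιK P hX h5 hs hN hK hodd hpd hμ hHN hLt hP hc hPinf κ hκ γ ι' w₀ P' hP' e
    he A ΩK C Ωp Q hA hΩK hC hΩp hQ
  have hpN : p ∣ N := hN ▸ dvd_conductorNorm_of_mult hX.2.2.1
  obtain ⟨ΩK₁, c', hΩK₁, hc', hBDP⟩ :=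
    exists_isBDPLFunctionInt_of_isHsiehLFunction ι' _ κ γ Dt.f hpN hA hΩK hC Ωp hQ
  refine ⟨ΩK₁, Ωp, PowerSeries.C c' * Q, hΩK₁, hΩp, hBDP, ?_⟩
  rwa [Ideal.span_singleton_mul_left_unit
    ((isUnit_padicComplexInt_of_norm_eq_one hc').map PowerSeries.C) Q]

end Summit.BirchSwinnertonDyer.Rank1Residual.X11b

end
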